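import Summits.Ventures.PercRepro.Night2LocalLineGeom

/-!
# PercRepro — the line case (C1) of the local form at `q = 2` (night-2, gen 7)

`M` loopless, `G` a plane with exactly two ground elements outside it, carrying a line `F` with `|E ∖ F| = 3`
(so `G ∖ F = {z}`).  The fractional matching of `proofs/NIGHT-2-local.md` §7: a member `B` gives
`c(m_B) · 2^{-|S ∖ B|}` to every shadow set `S` of which it is the exact trace, `m_B = |G ∖ cl B|`,
`c(m) = (4/3)·(m/(m+2)) / ((3/2)^m − 1)` (`Night2LocalDyadic.lean`).

* row sums: `c(m)·((3/2)^m − 1) = (4/3)·m/(m+2) = (4/3)·localWeight` (`|E ∖ cl B| = m + 2`);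
* column sums (`lineCase_column_le_one`): the exact members of `S` with closure `F` contribute at most `4/9`
  (one member, `S ∖ B = {z}`, `c(1) = 8/9`); those through `z` have pairwise disjoint parts
  `B.erase z ⊆ S.erase z` (`Night2LocalLineGeom.lean`) — if one of them has `m = 1` it is alone and contributes
  at most `4/9`, otherwise `c(m) ≤ 8/15` and `Σ 2^{|part|} ≤ 2^{|S.erase z|}` (`sum_two_pow_le_two_pow`), so the
  total is at most `4/9 + 8/15 = 44/45`.

**`lineCaseTwo_of_loopless`**: `LineCaseTwo M` for every loopless finite matroid; hence, with the case split of
`Night2LocalTwoSplit.lean`, **`shadowHall_four_two_of_loopless`**: `ShadowHall M 4 2 (phiK 4 2)`.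
-/

namespace PercRepro.Shadow

open Finset PerFlat ThmH

variable {α : Type*} [DecidableEq α] {M : Matroid α} [M.Finite]

omit [DecidableEq α] in
/-- `(1/2)^(a − b) = 2^b / 2^a` for `b ≤ a`. -/
theorem half_pow_sub_eq {a b : ℕ} (hle : b ≤ a) : (1 / 2 : ℚ) ^ (a - b) = (2 : ℚ) ^ b / (2 : ℚ) ^ a := by
  have h2 : (0 : ℚ) < (2 : ℚ) ^ a := by positivity
  rw [eq_div_iff h2.ne']
  obtain ⟨k, rfl⟩ : ∃ k, a = b + k := ⟨a - b, by omega⟩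
  rw [Nat.add_sub_cancel_left, pow_add]
  calc (1 / 2 : ℚ) ^ k * ((2 : ℚ) ^ b * (2 : ℚ) ^ k) = (2 : ℚ) ^ b * ((1 / 2 : ℚ) * 2) ^ k := by
        rw [mul_pow]; ring
    _ = (2 : ℚ) ^ b := by norm_num

/-- The exact members of `S`: the members of `𝒜` inside `G` with `B ⊆ S` and `S ∩ cl B = B`. -/
noncomputable def exactMembers (M : Matroid α) [M.Finite] (𝒜 : Finset (Finset α)) (G S : Finset α) :
    Finset (Finset α) :=
  (membersIn M 𝒜 G).filter (fun B => B ⊆ S ∧ S ∩ clF M B = B)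

/-- Membership in `exactMembers`. -/
theorem mem_exactMembers {𝒜 : Finset (Finset α)} {G S B : Finset α} :
    B ∈ exactMembers M 𝒜 G S ↔ B ∈ membersIn M 𝒜 G ∧ B ⊆ S ∧ S ∩ clF M B = B := by
  unfold exactMembers
  rw [Finset.mem_filter]

/-- The weighted column sum is a sum over the exact members. -/
theorem sum_dyadic_col_eq {𝒜 : Finset (Finset α)} (G S : Finset α) (c : Finset α → ℚ) :
    ∑ B ∈ membersIn M 𝒜 G, c B * dyadicWeight M B S =
      ∑ B ∈ exactMembers M 𝒜 G S, c B * (1 / 2 : ℚ) ^ (S \ B).card := by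
  unfold exactMembers
  rw [Finset.sum_filter]
  apply Finset.sum_congr rfl
  intro B _
  unfold dyadicWeight
  split_ifs <;> simp

/-- `S ∖ B` is nonempty for an exact member (`S` has rank `q + 1`, `B` rank `q`). -/
theorem one_le_card_sdiff_of_exact {q : ℕ} {𝒜 : Finset (Finset α)} (h𝒜 : 𝒜 ⊆ Uq M (q + 2) q) {G S B : Finset α}
    (hS : S ∈ shadowAt M (q + 2) q 𝒜 G) (hB : B ∈ membersIn M 𝒜 G) (hBS : B ⊆ S) : 1 ≤ (S \ B).card := by
  rw [Nat.one_le_iff_ne_zero, Ne, Finset.card_eq_zero, Finset.sdiff_eq_empty_iff_subset]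
  intro hSB
  have hSeq : S = B := le_antisymm hSB hBS
  have hr := eRk_eq_of_mem_Yq_diag (shadow_subset_Yq _ (mem_shadowAt.1 hS).1)
  rw [hSeq, (mem_Uq.1 (h𝒜 (mem_membersIn.1 hB).1)).2.1] at hr
  have : q = q + 1 := by exact_mod_cast hr
  omega

/-- **The column bound of the line case**: every shadow set carries at most `44/45 ≤ 1`. -/
theorem lineCase_column_le_one {𝒜 : Finset (Finset α)} (h𝒜 : 𝒜 ⊆ Uq M (2 + 2) 2) {G F : Finset α}
    (hG : G ∈ flatsQ M (2 + 1)) (hF : F ∈ flatsQ M 2) (hd : (gr M \ G).card = 2) {z : α}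
    (hz : G \ F = {z}) (hloop : ∀ e ∈ gr M, M.Indep {e}) {S : Finset α}
    (hS : S ∈ shadowAt M (2 + 2) 2 𝒜 G) :
    ∑ B ∈ membersIn M 𝒜 G, dyadicConst (G \ clF M B).card * dyadicWeight M B S ≤ 1 := by
  classical
  rw [sum_dyadic_col_eq]
  set 𝓔 := exactMembers M 𝒜 G S with h𝓔
  have hmem : ∀ B ∈ 𝓔, B ∈ membersIn M 𝒜 G ∧ B ⊆ S ∧ S ∩ clF M B = B := fun B hB => mem_exactMembers.1 hB
  have hzS : z ∈ S := mem_of_mem_shadowAt (𝒜 := 𝒜) hF hz hS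
  -- split by the closure being F or not
  rw [← Finset.sum_filter_add_sum_filter_not 𝓔 (fun B => clF M B = F)]
  -- the F-part: at most one member, each contributing 4/9
  have hFpart : ∑ B ∈ 𝓔.filter (fun B => clF M B = F), dyadicConst (G \ clF M B).card * (1 / 2 : ℚ) ^ (S \ B).card
      ≤ 4 / 9 := by
    have hterm : ∀ B ∈ 𝓔.filter (fun B => clF M B = F),
        dyadicConst (G \ clF M B).card * (1 / 2 : ℚ) ^ (S \ B).card = 4 / 9 := by
      intro B hB
      rw [Finset.mem_filter] at hB
      obtain ⟨hB𝓔, hBF⟩ := hB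
      obtain ⟨hBm, hBS, hSB⟩ := hmem B hB𝓔
      rw [hBF, hz, Finset.card_singleton, dyadicConst_one,
        sdiff_eq_singleton_of_exact hG hF hz hS hBS hSB hBF, Finset.card_singleton]
      norm_num
    have hcard : (𝓔.filter (fun B => clF M B = F)).card ≤ 1 := by
      rw [Finset.card_le_one]
      intro B hB B' hB'
      rw [Finset.mem_filter] at hB hB'
      rw [← (hmem B hB.1).2.2, ← (hmem B' hB'.1).2.2, hB.2, hB'.2]
    rw [Finset.sum_congr rfl hterm, Finset.sum_const, nsmul_eq_mul]
    have : ((𝓔.filter (fun B => clF M B = F)).card : ℚ) ≤ 1 := by exact_mod_cast hcard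
    nlinarith
  -- the z-part
  set 𝓔z := 𝓔.filter (fun B => ¬ clF M B = F) with h𝓔z
  have hzcl : ∀ B ∈ 𝓔z, z ∈ clF M B := by
    intro B hB
    rw [h𝓔z, Finset.mem_filter] at hB
    rcases exact_clF_eq_or_mem h𝒜 hF hz (hmem B hB.1).1 with h | h
    · exact absurd h hB.2
    · exact h
  have hzB : ∀ B ∈ 𝓔z, z ∈ B := fun B hB =>
    mem_of_exact hF hz hS (hmem B (Finset.mem_filter.1 hB).1).2.2 (hzcl B hB)
  -- |S ∖ B| = |S.erase z| - |B.erase z| for B ∈ 𝓔z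
  have hsdiff : ∀ B ∈ 𝓔z, S \ B = S.erase z \ B.erase z := by
    intro B hB
    have hzB' := hzB B hB
    ext x
    rw [Finset.mem_sdiff, Finset.mem_sdiff, Finset.mem_erase, Finset.mem_erase]
    constructor
    · rintro ⟨hxS, hxB⟩
      have hxz : x ≠ z := fun h => hxB (h ▸ hzB')
      exact ⟨⟨hxz, hxS⟩, fun h => hxB h.2⟩
    · rintro ⟨⟨hxz, hxS⟩, hxB⟩
      exact ⟨hxS, fun h => hxB ⟨hxz, h⟩⟩
  have hpartsub : ∀ B ∈ 𝓔z, B.erase z ⊆ S.erase z := fun B hB =>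
    Finset.erase_subset_erase _ (hmem B (Finset.mem_filter.1 hB).1).2.1
  have hcardsdiff : ∀ B ∈ 𝓔z, (S \ B).card = (S.erase z).card - (B.erase z).card := by
    intro B hB
    rw [hsdiff B hB, Finset.card_sdiff_of_subset (hpartsub B hB)]
  have hm1 : ∀ B ∈ 𝓔z, 1 ≤ (G \ clF M B).card := fun B hB =>
    one_le_card_sdiff_clF hG (h𝒜 (mem_membersIn.1 (hmem B (Finset.mem_filter.1 hB).1).1).1)
  have hzpart : ∑ B ∈ 𝓔z, dyadicConst (G \ clF M B).card * (1 / 2 : ℚ) ^ (S \ B).card ≤ 8 / 15 := by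
    by_cases hone : ∃ B₁ ∈ 𝓔z, (G \ clF M B₁).card = 1
    · obtain ⟨B₁, hB₁, hc₁⟩ := hone
      have hsingle : 𝓔z = {B₁} := by
        ext B
        rw [Finset.mem_singleton]
        constructor
        · intro hB
          exact exact_unique_of_card_one h𝒜 hG hF hd hz hloop hS (hmem B₁ (Finset.mem_filter.1 hB₁).1).1
            (hmem B₁ (Finset.mem_filter.1 hB₁).1).2.2 (hzcl B₁ hB₁) hc₁ (hmem B (Finset.mem_filter.1 hB).1).1
            (hmem B (Finset.mem_filter.1 hB).1).2.2 (hzcl B hB)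
        · rintro rfl
          exact hB₁
      rw [hsingle, Finset.sum_singleton, hc₁, dyadicConst_one]
      have h1 := one_le_card_sdiff_of_exact h𝒜 hS (hmem B₁ (Finset.mem_filter.1 hB₁).1).1
        (hmem B₁ (Finset.mem_filter.1 hB₁).1).2.1
      have hpow : (1 / 2 : ℚ) ^ (S \ B₁).card ≤ (1 / 2 : ℚ) ^ 1 :=
        pow_le_pow_of_le_one (by norm_num) (by norm_num) h1
      have : (8 / 9 : ℚ) * (1 / 2 : ℚ) ^ (S \ B₁).card ≤ (8 / 9 : ℚ) * (1 / 2 : ℚ) ^ 1 :=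
        mul_le_mul_of_nonneg_left hpow (by norm_num)
      linarith
    · have hm2 : ∀ B ∈ 𝓔z, 2 ≤ (G \ clF M B).card := by
        intro B hB
        have h1 := hm1 B hB
        by_contra hlt
        exact hone ⟨B, hB, by omega⟩
      -- Σ 2^{|part|} ≤ 2^{|S.erase z|}
      have hparts : ∑ B ∈ 𝓔z, 2 ^ (B.erase z).card ≤ 2 ^ (S.erase z).card := by
        rcases Nat.lt_or_ge 𝓔z.card 2 with hlt | hge
        · calc ∑ B ∈ 𝓔z, 2 ^ (B.erase z).card ≤ ∑ _B ∈ 𝓔z, 2 ^ (S.erase z).card :=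
                Finset.sum_le_sum (fun B hB => Nat.pow_le_pow_right (by norm_num)
                  (Finset.card_le_card (hpartsub B hB)))
            _ = 𝓔z.card * 2 ^ (S.erase z).card := by rw [Finset.sum_const, smul_eq_mul]
            _ ≤ 1 * 2 ^ (S.erase z).card := Nat.mul_le_mul_right _ (by omega)
            _ = 2 ^ (S.erase z).card := one_mul _
        · have hdisj : (𝓔z : Set (Finset α)).PairwiseDisjoint (fun B => B.erase z) := by
            intro B hB B' hB' hne
            rw [Finset.mem_coe] at hB hB'
            exact exact_parts_disjoint h𝒜 hG hF hz hloop (S := S) (hmem B (Finset.mem_filter.1 hB).1).1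
              (hmem B (Finset.mem_filter.1 hB).1).2.2 (hzcl B hB) (hmem B' (Finset.mem_filter.1 hB').1).1
              (hmem B' (Finset.mem_filter.1 hB').1).2.2 (hzcl B' hB') hne
          have hsumcard : ∑ B ∈ 𝓔z, (B.erase z).card ≤ (S.erase z).card := by
            rw [← Finset.card_biUnion hdisj]
            exact Finset.card_le_card (Finset.biUnion_subset.2 hpartsub)
          calc ∑ B ∈ 𝓔z, 2 ^ (B.erase z).card ≤ 2 ^ (∑ B ∈ 𝓔z, (B.erase z).card) :=
                sum_two_pow_le_two_pow 𝓔z (fun B => (B.erase z).card)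
                  (fun B hB => Finset.card_pos.2 (part_nonempty h𝒜 (hmem B (Finset.mem_filter.1 hB).1).1 (hzB B hB)))
                  hge
            _ ≤ 2 ^ (S.erase z).card := Nat.pow_le_pow_right (by norm_num) hsumcard
      have hpartsQ : ∑ B ∈ 𝓔z, (2 : ℚ) ^ (B.erase z).card ≤ (2 : ℚ) ^ (S.erase z).card := by
        exact_mod_cast hparts
      have h2pos : (0 : ℚ) < (2 : ℚ) ^ (S.erase z).card := by positivity
      have hsumhalf : ∑ B ∈ 𝓔z, (1 / 2 : ℚ) ^ (S \ B).card ≤ 1 := by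
        have : ∑ B ∈ 𝓔z, (1 / 2 : ℚ) ^ (S \ B).card =
            (∑ B ∈ 𝓔z, (2 : ℚ) ^ (B.erase z).card) / (2 : ℚ) ^ (S.erase z).card := by
          rw [Finset.sum_div]
          apply Finset.sum_congr rfl
          intro B hB
          rw [hcardsdiff B hB, half_pow_sub_eq (Finset.card_le_card (hpartsub B hB))]
        rw [this, div_le_one h2pos]
        exact hpartsQ
      calc ∑ B ∈ 𝓔z, dyadicConst (G \ clF M B).card * (1 / 2 : ℚ) ^ (S \ B).card
          ≤ ∑ B ∈ 𝓔z, (8 / 15 : ℚ) * (1 / 2 : ℚ) ^ (S \ B).card := by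
            apply Finset.sum_le_sum
            intro B hB
            exact mul_le_mul_of_nonneg_right (dyadicConst_le (hm2 B hB)) (by positivity)
        _ = (8 / 15 : ℚ) * ∑ B ∈ 𝓔z, (1 / 2 : ℚ) ^ (S \ B).card := by rw [Finset.mul_sum]
        _ ≤ (8 / 15 : ℚ) * 1 := mul_le_mul_of_nonneg_left hsumhalf (by norm_num)
        _ = 8 / 15 := mul_one _
  linarith

/-- **The line case holds for loopless matroids**: `LineCaseTwo M`. -/
theorem lineCaseTwo_of_loopless (hloop : ∀ e ∈ gr M, M.Indep {e}) : LineCaseTwo M := by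
  classical
  intro G hG hd hex _h3
  obtain ⟨B₀, hB₀, hB₀G, hc₀⟩ := hex
  have hF : clF M B₀ ∈ flatsQ M 2 := clF_mem_flatsQ hB₀
  have hsum := card_compl_clF_add hG hB₀G
  rw [hc₀, hd] at hsum
  have hc1 : (G \ clF M B₀).card = 1 := by omega
  obtain ⟨z, hz⟩ := Finset.card_eq_one.1 hc1
  apply localShadowHall_of_weights
  intro 𝒜 h𝒜
  refine ⟨fun B S => dyadicConst (G \ clF M B).card * dyadicWeight M B S, ?_, ?_, ?_⟩
  · intro B S
    apply mul_nonneg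
    · unfold dyadicConst
      rcases Nat.eq_zero_or_pos (G \ clF M B).card with h0 | hpos
      · rw [h0]; norm_num
      · have := three_half_pow_sub_one_pos hpos
        positivity
    · unfold dyadicWeight
      split_ifs <;> positivity
  · intro S hS
    exact lineCase_column_le_one h𝒜 hG hF hd hz hloop hS
  · intro B hB
    have hBU : B ∈ Uq M (2 + 2) 2 := h𝒜 (mem_membersIn.1 hB).1
    have hm := one_le_card_sdiff_clF hG hBU
    rw [← Finset.mul_sum, sum_dyadicWeight h𝒜 hG hB, dyadicConst_mul hm]
    unfold localWeight
    rw [card_compl_clF_add hG (mem_membersIn.1 hB).2, hd]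
    push_cast
    norm_num

/-- **The diagonal shadow form of C-025 at `q = 2` for every loopless finite matroid.** -/
theorem shadowHall_four_two_of_loopless (hloop : ∀ e ∈ gr M, M.Indep {e}) : ShadowHall M 4 2 (phiK 4 2) :=
  shadowHall_four_two_of_lineCase (lineCaseTwo_of_loopless hloop)

end PercRepro.Shadow
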